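import Summits.KontsevichZagierPeriods.KontsevichZagierPeriods.Theorems.HurwitzMicroSectorsNormalFormPrincipleM4SharedTools

/-!
# `NormalFormPrinciple` (stmt-KontsevichZagierPeriods-3869), line `SketchIdeator1` —
# leaf `stub_boxRigidity`, layer `Island`: the rule-(1b) split of `q·V` at height `q`

The PRODUCT ISLAND at height `q` (`q : ℕ`, `2 ≤ q`) is a dimension-two layer of the leaf
`stub_boxRigidity`: atoms on the open square `□² = {x | ∀ i, x i ∈ Ioo 0 1}` with denominators
`(q − x₀)`, `(q − x₁)`, `(q − x₀x₁)`. This file is step (i) of the chain `2q·V ∼ 2D + P`: the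
single integrand-additivity move (Kontsevich–Zagier, rule (1b)) realising the partial fraction
`q / ((q − x₀)(q − x₀x₁)) = 1 / (q − x₀x₁) + x₀ / ((q − x₀)(q − x₀x₁))`
on `□²` (common denominator `(q − x₀)(q − x₀x₁)`, numerator `(q − x₀) + x₀ = q`), i.e.
`[Vq] − [D] − [W] ∈ relations` for any carriers `Vq`, `D`, `W` of the three integrands on the
box. For `q ≥ 2` both denominators are `≥ q − 1 ≥ 1` on the box, so the identity holds pointwise
on the whole domain.
References: M. Kontsevich, D. Zagier, *Periods* (2001), §1.1–1.2. No definitions are introduced.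
-/

noncomputable section

open MeasureTheory Set
open Literature.NumberTheory.Transcendental Literature.NumberTheory.Transcendental.KZ

namespace Summit.KontsevichZagierPeriods.HurwitzMicroSectors.NormalFormPrinciple.PiBox.Island

/-- **The pointwise split.** `q / ((q − a)(q − ab)) = 1 / (q − ab) + a / ((q − a)(q − ab))`
whenever both denominators are nonzero. [folklore] -/
private theorem isqv_split_identity {q a b : ℝ} (ha : q - a ≠ 0) (hab : q - a * b ≠ 0) :
    q / ((q - a) * (q - a * b)) = 1 / (q - a * b) + a / ((q - a) * (q - a * b)) := by
  field_simp
  ring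

/-- **Step (i) of the island chain `2q·V ∼ 2D + P`: the rule-(1b) split of `q·V`.** For `q ≥ 2`
and carriers `Vq = [□², q/((q − x₀)(q − x₀x₁))]`, `D = [□², 1/(q − x₀x₁)]`,
`W = [□², x₀/((q − x₀)(q − x₀x₁))]` (integrands pinned on the open box only),
`[Vq] − [D] − [W]` is ONE integrand-additivity move of the Kontsevich–Zagier calculus: on the box
`q − x₀ ≥ q − 1 > 0` and `q − x₀x₁ ≥ q − 1 > 0`, and the integrands satisfy
`Vq = D + W` pointwise there. [cite: KontsevichZagier2001, §1.2 rule (1)] -/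
theorem isl_split_qV :
    ∀ (q : ℕ), 2 ≤ q → ∀ (Vq D W : IntegralRep 2),
      Vq.domain = {x | ∀ i, x i ∈ Set.Ioo (0:ℝ) 1} →
      EqOn Vq.integrand (fun x => (q:ℝ) / (((q:ℝ) - x 0) * ((q:ℝ) - x 0 * x 1))) Vq.domain →
      D.domain = {x | ∀ i, x i ∈ Set.Ioo (0:ℝ) 1} →
      EqOn D.integrand (fun x => 1 / ((q:ℝ) - x 0 * x 1)) D.domain →
      W.domain = {x | ∀ i, x i ∈ Set.Ioo (0:ℝ) 1} →
      EqOn W.integrand (fun x => x 0 / (((q:ℝ) - x 0) * ((q:ℝ) - x 0 * x 1))) W.domain →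
      of Vq - of D - of W ∈ relations := by
  intro q hq Vq D W hVqd hVqi hDd hDi hWd hWi
  have hq' : (2:ℝ) ≤ q := by exact_mod_cast hq
  refine integrandAddRel_subset_relations
    ⟨2, Vq, D, W, hDd.trans hVqd.symm, hWd.trans hVqd.symm, fun x hx => ?_, rfl⟩
  -- the point lies in the open box, hence in the domains of `D` and `W`
  have hx' : ∀ i, x i ∈ Set.Ioo (0:ℝ) 1 := by rw [hVqd] at hx; exact hx
  have hxD : x ∈ D.domain := by rw [hDd]; exact hx'
  have hxW : x ∈ W.domain := by rw [hWd]; exact hx'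
  -- nonvanishing of the two denominators (`2 ≤ q` is used here)
  have h01 : x 0 * x 1 < 1 :=
    mul_lt_one_of_nonneg_of_lt_one_left (hx' 0).1.le (hx' 0).2 (hx' 1).2.le
  have h0 : (q:ℝ) - x 0 ≠ 0 := (sub_pos.2 (by linarith [(hx' 0).2])).ne'
  have h1 : (q:ℝ) - x 0 * x 1 ≠ 0 := (sub_pos.2 (by linarith)).ne'
  rw [Pi.add_apply, hVqi hx, hDi hxD, hWi hxW]
  exact isqv_split_identity h0 h1

end Summit.KontsevichZagierPeriods.HurwitzMicroSectors.NormalFormPrinciple.PiBox.Island
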